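import Summits.ResolutionOfSingularities.ResolutionOfSingularities.Theorems.HilbertSamuelEliminationSigmaMaxModificationsCorridor3WLadderStrataStrictDominant
import Summits.ResolutionOfSingularities.ResolutionOfSingularities.Theorems.HilbertSamuelEliminationSigmaMaxModificationsCorridor3WLadderStrataCycleStart
import Summits.ResolutionOfSingularities.ResolutionOfSingularities.Theorems.HilbertSamuelEliminationSigmaMaxModificationsCorridor3WLadderStrataNearFibre
import Literature.AlgebraicGeometry.Resolution.BlowupStrictTransform
import Literature.AlgebraicGeometry.Resolution.AlterationsNormalFormStrictTransform
import Literature.AlgebraicGeometry.Resolution.AlterationsBoundaryDivisor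
import Literature.AlgebraicGeometry.Resolution.ComponentGluing
import Literature.AlgebraicGeometry.Resolution.BlowupsIntegral
import Literature.AlgebraicGeometry.Resolution.StalkIdealLemmas
import Literature.AlgebraicGeometry.Resolution.BlowupsFlatBaseChange
import Literature.RingTheory.RegularLocalRing.QuotientDVR
import Summits.ResolutionOfSingularities.ResolutionOfSingularities.Theorems.HilbertSamuelEliminationSigmaMaxModificationsCorridor3WLadderStrataCurveDictionary
import HarnessLib

/-!
# [OURS · L1 W4.2] The STRATA-half of the MOVING W-ladder, ninth layer (part 2b): kernel (K-str) PROVED — the strict transform of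
# a curve regular at the chain point, under a blow-up whose centre does not contain it, is a regular curve at its point over it

Crux chain w42 (`SigmaMaxModifications`, stmt-ResolutionOfSingularities-18506; skeleton `w_ladder` v6/v7 on
`SigmaMaxModificationsCorridor3`, stmt-ResolutionOfSingularities-19249), row «stub-4 → `Moving.Wlow3CharStrataM p`», kernel (K-str)
`StrataStrictTransformClean` (p516588), seat res-L1-w42-stub-4 (gen 4). OURS (cell res-hironaka, slot W4.2); NOT statements of
H. Hironaka's manuscript [Hironaka2017] nor of [CossartJannsenSaito2020]; AI-drafted, weaker than expert review. Pure proofs (no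
definitions). Helper file `--supports stmt-ResolutionOfSingularities-19249`.

## The argument

Let `π : X' = Bl_C(X) → X` (Noetherian), `Z ⊆ X` irreducible closed, `Z ⊄ V(C)`, `x ∈ Z` with `𝒪_{X,x}/I(Z)_x` regular of dimension
`≤ 1`. Put the reduced structure `Y = Z_red ↪ X` (integral) and let `ρ : Y' = Bl_{C·𝒪_Y}(Y) → Y`; the strict transform morphism
`j : Y' → X'` is a closed immersion with image the strict transform `Z̃ = closure π⁻¹(Z ∖ V(C))` (GW Prop. 13.91 (1), 13.96 (2), in the
tree: `isClosedImmersion_strictTransform`, `range_eq_strictTransformSet`), and identifies `Y'` (reduced) with `Z̃_red`. At the point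
`c ∈ Y` over `x`, `𝒪_{Y,c} ≅ 𝒪_{X,x}/I(Z)_x` is regular of dimension `≤ 1`, hence a principal ideal ring, so the stalk `(C·𝒪_Y)_c` is
principal — and non-zero (`Z ⊄ V(C)`): `C·𝒪_Y` is an effective Cartier divisor on an affine neighbourhood `V ∋ c`, over which the blow-up
`ρ` is therefore an ISOMORPHISM (`IsBlowup.restrict`, `IsBlowup.isIso`). So for `x' ∈ Z̃` over `x`, with `x' = j(c')`, `ρ(c') = c`:
`𝒪_{X',x'}/I(Z̃)_{x'} ≅ 𝒪_{Y',c'} ≅ 𝒪_{Y,c}` — regular of dimension `≤ 1`. The topological clause «curve at the point» is exchanged with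
«`dim ≤ 1`» in both directions by the dictionary «generisations = primes of the local ring» (Stacks 01J7).

## What is proved

* (part 2a, `…Corridor3WLadderStrataCurveDictionary`: the dictionary «regular curve at the point» ⟷ «`dim 𝒪_{X,x}/I(Z)_x ≤ 1`» and the
  local effective-Cartier criterion.)
* §2 `isRegularLocalRing_and_dim_strictTransform` — the core statement above, on the chosen blow-up `blowup C`.
* §3 `strataStrictTransformClean_holds : ∀ p N Q G, StrataStrictTransformClean p N Q G` — **KERNEL (K-str) CLOSED** (with p519120's
  uniqueness): hence `strataCycleStartRegular_of_centreMembersClean : StrataCentreMembersClean p N Q G → StrataCycleStartRegular p N Q G`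
  and the strata-half reads `Wlow3CharStrataM p ⟸ h314 ∧ h314f ∧ (c-geo) ∧ (K-ctr)`.

References: Görtz–Wedhorn I Prop. 13.91, 13.96 (2), (13.19) [GortzWedhorn2020]; Stacks 01J7, 0804 [StacksProject]; Matsumura Thm. 11.2
[Matsumura1987]; CJS LNM 2270 Rem. 6.29 (1), Lemma 3.15 (1) [CossartJannsenSaito2020]; tree `…BlowupStrictTransform`,
`…AlterationsNormalFormStrictTransform`, `…AlterationsBoundaryDivisor`, `…ComponentGluing`, `…BlowupsIntegral`, `…SncStrata`,
`…BlowupsFlatBaseChange`, `Literature.RingTheory.RegularLocalRing.QuotientDVR`.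
-/

noncomputable section

-- plan-1/idea-2 module setting kept (namespace `…Corridor3.Moving` re-enters `…Corridor3`)
set_option linter.dupNamespace false

open CategoryTheory AlgebraicGeometry TopologicalSpace Topology IsLocalRing
open Summit.ResolutionOfSingularities.ResolutionOfSingularities.Theorems.CampaignW42
open Literature.AlgebraicGeometry.Resolution Literature.RingTheory.HilbertSamuel
open Literature.AlgebraicGeometry.CossartJannsenSaito2020
open Summit.ResolutionOfSingularities.ResolutionOfSingularities.Theorems.SigmaMaxModificationsCorridor3

universe u

namespace Summit.ResolutionOfSingularities.ResolutionOfSingularities.Theorems.SigmaMaxModificationsCorridor3.Moving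

variable {R : ∀ S : Scheme.{u}, CentreSeq S → Prop} {N : ℕ} {ν : ℕ → ℕ}

/-! ## §2. The strict transform of a curve regular at `x` is a regular curve at its points over `x` -/

/-- **CORE.** On the chosen blow-up `π : Bl_C(W) → W` of a Noetherian `W`: if `Z ⊆ W` is irreducible closed, NOT inside `V(C)`, and
`x ∈ Z` has `𝒪_{W,x}/I(Z)_x` regular of dimension `≤ 1`, then at every point `x'` of the strict transform `Z̃ = closure π⁻¹(Z ∖ V(C))`
over `x`, `𝒪_{Bl,x'}/I(Z̃)_{x'}` is regular of dimension `≤ 1` (GW Prop. 13.91/13.96: `Z̃ ≅ Bl_{C·𝒪_Z}(Z_red)`, an isomorphism over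
the neighbourhood of `x` where the non-zero ideal `C·𝒪_{Z,x}` of the principal ideal ring `𝒪_{Z,x}` is invertible).
[cite: GortzWedhorn2020, Prop. 13.91, Prop. 13.96 (2)] -/
theorem isRegular_and_dim_le_one_strictTransform_blowup {W : Scheme.{u}} [IsNoetherian W] (C : W.IdealSheafData)
    {Z : Set W} (hZirr : IsIrreducible Z) (hZcl : IsClosed Z) (hZC : ¬ Z ⊆ (C.support : Set W)) {x : W} (hxZ : x ∈ Z)
    (hreg : IsRegularLocalRing (W.presheaf.stalk x ⧸ stalkIdeal (Scheme.IdealSheafData.vanishingIdeal ⟨Z, hZcl⟩) x))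
    (hdim : ringKrullDim (W.presheaf.stalk x ⧸ stalkIdeal (Scheme.IdealSheafData.vanishingIdeal ⟨Z, hZcl⟩) x) ≤ 1)
    {x' : ↥(blowup C)} (hx' : x' ∈ strictTransformSet (blowup.π C) (C.support : Set W) Z)
    (hπx' : (blowup.π C).base x' = x) :
    IsRegularLocalRing ((blowup C).presheaf.stalk x' ⧸ stalkIdeal (Scheme.IdealSheafData.vanishingIdeal
        ⟨strictTransformSet (blowup.π C) (C.support : Set W) Z, strictTransformSet.isClosed _ _ _⟩) x') ∧
      ringKrullDim ((blowup C).presheaf.stalk x' ⧸ stalkIdeal (Scheme.IdealSheafData.vanishingIdeal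
        ⟨strictTransformSet (blowup.π C) (C.support : Set W) Z, strictTransformSet.isClosed _ _ _⟩) x') ≤ 1 := by
  -- the reduced structure `Y` on `Z`, integral; the point `c` over `x`
  set 𝒥 : W.IdealSheafData := Scheme.IdealSheafData.vanishingIdeal ⟨Z, hZcl⟩ with h𝒥
  haveI hYint : IsIntegral 𝒥.subscheme := ComponentGluing.isIntegral_subscheme_vanishingIdeal ⟨Z, hZcl⟩ hZirr
  set i := 𝒥.subschemeι with hi
  haveI : IsLocallyNoetherian 𝒥.subscheme := LocallyOfFiniteType.isLocallyNoetherian i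
  have hrange : Set.range i.base = Z := range_subschemeι_vanishingIdeal ⟨Z, hZcl⟩
  obtain ⟨c, hc⟩ : ∃ c, i.base c = x := by rw [← Set.mem_range, hrange]; exact hxZ
  subst hc
  -- `𝒪_{Y,c}` is regular of dimension `≤ 1`, hence a principal ideal ring
  let ec := (nonempty_stalkSubschemeEquiv' 𝒥 c).some
  haveI hYreg : IsRegularLocalRing (𝒥.subscheme.presheaf.stalk c) := by
    haveI := hreg; exact IsRegularLocalRing.of_ringEquiv ec
  have hYdim : ringKrullDim (𝒥.subscheme.presheaf.stalk c) ≤ 1 := by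
    rw [← ringKrullDim_eq_of_ringEquiv ec]; exact hdim
  haveI : IsPrincipalIdealRing (𝒥.subscheme.presheaf.stalk c) := isPrincipalIdealRing_of_ringKrullDim_le_one hYdim
  -- `J = C · 𝒪_Y`; its stalk at `c` is principal …
  set J : 𝒥.subscheme.IdealSheafData := C.comap i with hJ
  obtain ⟨t, ht⟩ : ∃ t, stalkIdeal J c = Ideal.span {t} :=
    ⟨_, (Submodule.IsPrincipal.span_singleton_generator (stalkIdeal J c)).symm⟩
  -- … and non-zero: else `C_x ≤ I(Z)_x ≤ 𝔭_η` for the generic point `η` of `Z`, i.e. `Z ⊆ V(C)`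
  have ht0 : t ≠ 0 := by
    intro h0
    rw [h0, Ideal.span_singleton_eq_bot.mpr rfl, hJ, stalkIdeal_comap_eq_map_stalkMap] at ht
    have hker : RingHom.ker (i.stalkMap c).hom = stalkIdeal 𝒥 (i.base c) := by
      rw [← stalkIdeal_ker_eq_ker_stalkMap 𝒥.subschemeι c, Scheme.IdealSheafData.ker_subschemeι]
    have hle : stalkIdeal C (i.base c) ≤ stalkIdeal 𝒥 (i.base c) := by
      intro g hg
      rw [← hker, RingHom.mem_ker]
      have : (i.stalkMap c).hom g ∈ (stalkIdeal C (i.base c)).map (i.stalkMap c).hom := Ideal.mem_map_of_mem _ hg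
      rw [ht] at this
      exact this
    have hZgen : IsGenericPoint hZirr.genericPoint Z := hZirr.isGenericPoint_genericPoint hZcl
    have hη : hZirr.genericPoint ⤳ i.base c := hZgen.specializes hxZ
    have h1 : stalkIdeal 𝒥 (i.base c) ≤ primeOfSpecializes hη :=
      (mem_iff_stalkIdeal_vanishingIdeal_le (Z := ⟨Z, hZcl⟩) hη).mp hZgen.mem
    have h2 : hZirr.genericPoint ∈ C.support := (mem_support_iff_stalkIdeal_le_primeOfSpecializes hη C).mpr (hle.trans h1)
    exact hZC (by rw [← hZgen.def]; exact closure_minimal (Set.singleton_subset_iff.mpr h2) C.support.isClosed)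
  -- spread a generator to an affine neighbourhood `V` of `c`: `J(V) = (g)` with `g` a nonzerodivisor
  obtain ⟨U, hU, hcU, -⟩ :=
    exists_isAffineOpen_mem_and_subset (X := 𝒥.subscheme) (x := c) (U := ⊤) (Opens.mem_top c)
  have hspan : Ideal.span ((𝒥.subscheme.presheaf.germ U c hcU).hom '' (J.ideal ⟨U, hU⟩)) = Ideal.span {t} := by
    rw [← ht, stalkIdeal_eq_map_germ J ⟨U, hU⟩ hcU, Ideal.map]
  obtain ⟨_, ⟨sec, hsec, rfl⟩, hgen⟩ := exists_mem_span_singleton_eq_of_span_eq ht0 hspan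
  have hJsec : stalkIdeal J c = Ideal.span {(𝒥.subscheme.presheaf.germ U c hcU).hom sec} := by rw [hgen, ht]
  have hsec0 : (𝒥.subscheme.presheaf.germ U c hcU).hom sec ≠ 0 := by
    intro h0
    rw [h0, Ideal.span_singleton_eq_bot.mpr rfl, eq_comm, Ideal.span_singleton_eq_bot] at hgen
    exact ht0 hgen
  obtain ⟨V, hVU, hcV, hJV⟩ := exists_ideal_eq_span_singleton_of_stalkIdeal_eq J ⟨U, hU⟩ hcU sec hsec hJsec
  have hnzd : 𝒥.subscheme.presheaf.map (homOfLE hVU).op sec ∈ nonZeroDivisors Γ(𝒥.subscheme, V) := by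
    refine mem_nonZeroDivisors_of_germ_ne_zero hcV _ ?_
    rw [TopCat.Presheaf.germ_res_apply]
    exact hsec0
  have hCart : IsEffectiveCartier (J.comap (V : 𝒥.subscheme.Opens).ι) :=
    isEffectiveCartier_comap_ι_of_ideal_eq_span V hnzd hJV
  -- the blow-up `ρ` of `Y` along `J` is an isomorphism over `V`
  have hρ : IsBlowup (blowup.π J) J := blowup.isBlowup J
  haveI hρV : IsIso (blowup.π J ∣_ (V : 𝒥.subscheme.Opens)) := (hρ.restrict (V : 𝒥.subscheme.Opens)).isIso hCart
  -- the strict transform morphism `j : Y' → Bl_C(W)`: closed immersion with image the strict transform of `Z`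
  have hπ : IsBlowup (blowup.π C) C := blowup.isBlowup C
  set j := hπ.strictTransformHom hρ with hjdef
  have hjπ : j ≫ blowup.π C = blowup.π J ≫ i := hπ.strictTransformHom_comp hρ
  haveI : IsClosedImmersion j := hπ.isClosedImmersion_of_comp_eq hρ hjπ
  have hjrange : Set.range j.base = strictTransformSet (blowup.π C) (C.support : Set W) Z := by
    have := hπ.range_eq_strictTransformSet hρ hjπ j.isClosedEmbedding.isClosed_range
    rw [this, hrange]
  obtain ⟨c', hc'⟩ : ∃ c', j.base c' = x' := by rw [← Set.mem_range, hjrange]; exact hx'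
  have hρc' : (blowup.π J).base c' = c := by
    apply i.isClosedEmbedding.injective
    have := congrArg (fun φ => φ.base c') hjπ
    change (j ≫ blowup.π C).base c' = (blowup.π J ≫ i).base c' at this
    rw [Scheme.Hom.comp_apply, Scheme.Hom.comp_apply, hc', hπx'] at this
    exact this.symm
  -- `𝒪_{Y',c'} ≅ 𝒪_{Y,c}`: regular of dimension `≤ 1`
  have hc'V : (blowup.π J).base c' ∈ (V : 𝒥.subscheme.Opens) := by rw [hρc']; exact hcV
  haveI := isIso_stalkMap_of_isIso_morphismRestrict (blowup.π J) (V : 𝒥.subscheme.Opens) c' hc'V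
  let eρ : 𝒥.subscheme.presheaf.stalk ((blowup.π J).base c') ≃+* (blowup J).presheaf.stalk c' :=
    (asIso ((blowup.π J).stalkMap c')).commRingCatIsoToRingEquiv
  have hY'reg : IsRegularLocalRing ((blowup J).presheaf.stalk c') := by
    haveI : IsRegularLocalRing (𝒥.subscheme.presheaf.stalk ((blowup.π J).base c')) := by rw [hρc']; exact hYreg
    exact IsRegularLocalRing.of_ringEquiv eρ
  have hY'dim : ringKrullDim ((blowup J).presheaf.stalk c') ≤ 1 := by
    rw [← ringKrullDim_eq_of_ringEquiv eρ, hρc']; exact hYdim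
  -- `Y'` (reduced) IS the reduced closed subscheme on its image
  haveI : IsReduced (blowup J) := hρ.isReduced
  set 𝒥' : (blowup C).IdealSheafData :=
    Scheme.IdealSheafData.vanishingIdeal ⟨Set.range j.base, j.isClosedEmbedding.isClosed_range⟩ with h𝒥'
  have hker : 𝒥'.subschemeι.ker = j.ker := by
    rw [Scheme.IdealSheafData.ker_subschemeι, h𝒥', ker_eq_vanishingIdeal_range]
  haveI : IsIso (IsClosedImmersion.lift 𝒥'.subschemeι j hker.le) := IsClosedImmersion.isIso_lift _ _ hker
  set e := IsClosedImmersion.lift 𝒥'.subschemeι j hker.le with hedef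
  have hefac : e ≫ 𝒥'.subschemeι = j := IsClosedImmersion.lift_fac _ _ _
  let ee : 𝒥'.subscheme.presheaf.stalk (e.base c') ≃+* (blowup J).presheaf.stalk c' :=
    (asIso (e.stalkMap c')).commRingCatIsoToRingEquiv
  have hsubreg : IsRegularLocalRing (𝒥'.subscheme.presheaf.stalk (e.base c')) := by
    haveI := hY'reg; exact IsRegularLocalRing.of_ringEquiv ee.symm
  have hsubdim : ringKrullDim (𝒥'.subscheme.presheaf.stalk (e.base c')) ≤ 1 := by
    rw [ringKrullDim_eq_of_ringEquiv ee]; exact hY'dim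
  have hιe : 𝒥'.subschemeι.base (e.base c') = x' := by
    have := congrArg (fun φ => φ.base c') hefac
    change (e ≫ 𝒥'.subschemeι).base c' = j.base c' at this
    rw [Scheme.Hom.comp_apply, hc'] at this
    exact this
  -- back to the ambient quotient at `x'`
  let ex := (nonempty_stalkSubschemeEquiv' 𝒥' (e.base c')).some
  have hreg' : IsRegularLocalRing ((blowup C).presheaf.stalk (𝒥'.subschemeι.base (e.base c')) ⧸
      stalkIdeal 𝒥' (𝒥'.subschemeι.base (e.base c'))) := by
    haveI := hsubreg; exact IsRegularLocalRing.of_ringEquiv ex.symm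
  have hdim' : ringKrullDim ((blowup C).presheaf.stalk (𝒥'.subschemeι.base (e.base c')) ⧸
      stalkIdeal 𝒥' (𝒥'.subschemeι.base (e.base c'))) ≤ 1 := by
    rw [ringKrullDim_eq_of_ringEquiv ex]; exact hsubdim
  rw [hιe] at hreg' hdim'
  have h𝒥'eq : 𝒥' = Scheme.IdealSheafData.vanishingIdeal
      ⟨strictTransformSet (blowup.π C) (C.support : Set W) Z, strictTransformSet.isClosed _ _ _⟩ := by
    rw [h𝒥']; congr 1; exact Closeds.ext hjrange
  rw [h𝒥'eq] at hreg' hdim'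
  exact ⟨hreg', hdim'⟩


/-! ## §3. Kernel (K-str) CLOSED, and the strata-half with it discharged -/

/-- **(K-str) along one step projection**: under the cycle invariant, a component `Z ∋ x_n` of `X_n(ν)` off the canonical centre which
is a regular curve at `x_n` has, among the components of `X_{n+1}(ν)` through `x_{n+1}`, at most one dominant, and it is a regular
curve at `x_{n+1}`. [cite: GortzWedhorn2020, Prop. 13.91, Prop. 13.96 (2)] -/
theorem StepProjection.isRegularCurveAt_of_dominant {k : Type u} [Field k] (hRf : OracleFunctional R) (hRa : OracleAdmissible R)
    (hν : ν ≠ iterPSum N Phi) {s s' : MarkedStage.{u}} (h : CycleInv k R N ν s)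
    {f : s'.W ⟶ s.W} (hf : StepProjection R N ν s s' f) {C : s.W.IdealSheafData} {P' : Option (Pending (blowup C))}
    (hcs : IsCanonicalStep R N ν s.L s.P C P') {Z : Set s.W} (hZ : Z ∈ componentsThrough N ν s)
    (hZC : ¬ Z ⊆ (C.support : Set s.W)) (hreg : IsRegularCurveAt s Z) {Z' : Set s'.W} (hZ' : Z' ∈ componentsThrough N ν s')
    (hdom : closure (f.base '' Z') = Z) : IsRegularCurveAt s' Z' := by
  have h' : CycleInv k R N ν s' := h.step hRa hν hf.canonicalNearStep
  have hST := hf.eq_strictTransformSet_of_closure_image_eq hRf hRa hν h hcs hZ.1 hZC hZ'.1 hdom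
  obtain ⟨hxZ, hregZ, hcurveZ⟩ := hreg
  haveI := s.ln
  haveI : IsNoetherian s.W := h.isNoetherian
  have hZirr : IsIrreducible Z := componentsIn.isIrreducible hZ.1
  have hZcl : IsClosed Z := componentsIn.isClosed h.isClosed_hsStratum hZ.1
  have hZ'irr : IsIrreducible Z' := componentsIn.isIrreducible hZ'.1
  have hZ'cl : IsClosed Z' := componentsIn.isClosed h'.isClosed_hsStratum hZ'.1
  have hpt' : IsClosed ({s'.pt} : Set s'.W) := hf.canonicalNearStep.isClosed_pt
  have hdimZ := ringKrullDim_quotient_le_one_of_curve hZcl hcurveZ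
  obtain ⟨C₂, P₂, hln, x', hcs₂, hπ, hcl, hx', e, rfl⟩ := hf
  obtain rfl : C₂ = C := hcs₂.centre_unique hRf hcs
  subst e
  simp only [eqToHom_refl, Category.id_comp] at hST hdom ⊢
  haveI : IsNoetherian (blowup C₂) := h'.isNoetherian
  -- the core theorem at `x'`
  have hx'T : x' ∈ strictTransformSet (blowup.π C₂) (C₂.support : Set s.W) Z := hST ▸ hZ'.2
  obtain ⟨hreg', hdim'⟩ := isRegular_and_dim_le_one_strictTransform_blowup C₂ hZirr hZcl hZC hxZ (hregZ hZcl) hdimZ hx'T hπ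
  have hcleq : ∀ hcl' : IsClosed Z', (Scheme.IdealSheafData.vanishingIdeal (⟨Z', hcl'⟩ : Closeds ↥(blowup C₂))) =
      Scheme.IdealSheafData.vanishingIdeal ⟨strictTransformSet (blowup.π C₂) (C₂.support : Set s.W) Z,
        strictTransformSet.isClosed _ _ _⟩ := fun hcl' => by congr 1; exact Closeds.ext hST
  refine ⟨hZ'.2, fun hcl' => by rw [hcleq hcl']; exact hreg', ?_⟩
  exact curve_of_ringKrullDim_quotient_le_one hZ'irr hZ'cl hcl (by rw [hcleq hZ'cl]; exact hdim')

/-- **KERNEL (K-str) `StrataStrictTransformClean p N Q G` HOLDS** — for every characteristic, level, origin predicate and grade (from the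
first stage on). [cite: GortzWedhorn2020, Prop. 13.91, Prop. 13.96 (2)] -/
theorem strataStrictTransformClean_holds (p N : ℕ) (Q : ℕ → (ℕ → ℕ) → ∀ X : Scheme.{u}, X → Prop)
    (G : MarkedStage.{u} → Prop) : StrataStrictTransformClean p N Q G := by
  intro R hRf hRa ν X _ x hX _ c h0 hstep _ _ _
  obtain ⟨hν, k, _, hinv⟩ := exists_cycleInv_chain' hRf hRa hX h0 hstep
  refine ⟨0, fun n _ C P' hcs f hf Z hZ hZC hreg => ⟨fun Z' hZ' Z'' hZ'' hd' hd'' => ?_, fun Z' hZ' hd' => ?_⟩⟩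
  · exact hf.dominant_unique hRf hRa hν (hinv n) hcs hZ.1 hZC hZ'.1 hZ''.1 hd' hd''
  · exact hf.isRegularCurveAt_of_dominant hRf hRa hν (hinv n) hcs hZ hZC hreg hZ' hd'

/-- **ROW (c-reg) FROM THE ONE KERNEL (K-ctr)** (any `Q`, `G`): with (K-str) closed, p518012's reduction needs only «clean members over
the centre». [cite: CossartJannsenSaito2020, Rem. 6.29 (1)] -/
theorem strataCycleStartRegular_of_centreMembersClean {p N : ℕ} {Q : ℕ → (ℕ → ℕ) → ∀ X : Scheme.{u}, X → Prop}
    {G : MarkedStage.{u} → Prop} (hK : StrataCentreMembersClean p N Q G) : StrataCycleStartRegular p N Q G :=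
  strataCycleStartRegular_of_clean hK (strataStrictTransformClean_holds p N Q G)

/-- **`Wlow3CharStrataM p` (G1′) FROM the printed Thm. 3.14 (two renderings), the dimension-two kernel (c-geo) and the one-step kernel
(K-ctr).** [cite: CossartJannsenSaito2020, Thm. 3.14, Thm. 6.35, Rem. 6.29 (1)] -/
theorem wlow3CharStrataM_of_thm_3_14_nearFibre_centreIO_centreMembersClean {p : ℕ} (h314 : CossartJannsenSaito2020_thm_3_14.{0})
    (h314f : Thm314_nearFibre_subsingleton.{0})
    (hgeo : StrataLineageInCentreIO.{0} p 3 (QNe (Helpers.QCharRegime p)) fun s => s.geomDirDim ≤ 2)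
    (hK : StrataCentreMembersClean.{0} p 3 (QNe (Helpers.QCharRegime p)) fun s => s.geomDirDim ≤ 2) :
    Wlow3CharStrataM p :=
  wlow3CharStrataM_of_thm_3_14_nearFibre_centreIO_cycleStartRegular h314 h314f hgeo
    (strataCycleStartRegular_of_centreMembersClean hK)

/-- The strata-half at any origin predicate from (b-fib), (b-curve), (c-geo), (K-ctr). [cite: CossartJannsenSaito2020, Rem. 6.29 (1)] -/
theorem maxOriginNoMovingNearChainAtQ_notIso_of_fibre_curve_centreIO_centreMembersClean {p N : ℕ}
    {Q : ℕ → (ℕ → ℕ) → ∀ X : Scheme.{u}, X → Prop} {G : MarkedStage.{u} → Prop}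
    (hfib : StrataNearFibreSubsingleton p N (QNe Q) G) (hcurve : StrataCentreCurveAt p N (QNe Q) G)
    (hgeo : StrataLineageInCentreIO p N (QNe Q) G) (hK : StrataCentreMembersClean p N (QNe Q) G) :
    MaxOriginNoMovingNearChainAtQ p N Q fun s => G s ∧ ¬ Iso N s :=
  maxOriginNoMovingNearChainAtQ_notIso_of_fibre_curve_centreIO_cycleStartRegular hfib hcurve hgeo
    (strataCycleStartRegular_of_centreMembersClean hK)

/-- Exactness: the strata row at `Q` is EQUIVALENT to (b-fib) ∧ (b-curve) ∧ (c-geo) ∧ (K-ctr) at `QNe Q`. [folklore] -/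
theorem maxOriginNoMovingNearChainAtQ_notIso_iff_fibre_curve_centreIO_centreMembersClean {p N : ℕ}
    {Q : ℕ → (ℕ → ℕ) → ∀ X : Scheme.{u}, X → Prop} {G : MarkedStage.{u} → Prop} :
    (MaxOriginNoMovingNearChainAtQ p N Q fun s => G s ∧ ¬ Iso N s) ↔
      StrataNearFibreSubsingleton p N (QNe Q) G ∧ StrataCentreCurveAt p N (QNe Q) G ∧
        StrataLineageInCentreIO p N (QNe Q) G ∧ StrataCentreMembersClean p N (QNe Q) G := by
  rw [maxOriginNoMovingNearChainAtQ_notIso_iff_fibre_curve_centreIO_clean]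
  exact ⟨fun ⟨h1, h2, h3, h4, _⟩ => ⟨h1, h2, h3, h4⟩, fun ⟨h1, h2, h3, h4⟩ =>
    ⟨h1, h2, h3, h4, strataStrictTransformClean_holds p N (QNe Q) G⟩⟩


/-! ## §4 (appended, same seat). The replay row and the births row with (K-str) discharged -/

/-- **ROW (c-rep) FROM THE ONE KERNEL (K-ctr)** (any `Q`, any grade `G` — in particular the W-top grade `3 ≤ ē`, where (c-rep)₃ was
UNHELD): replay blow-ups of the chain point settle once the members over the centre are clean (p508074 ∘ p518012 ∘ (K-str)).
[cite: CossartJannsenSaito2020, Rem. 6.29 (1)] -/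
theorem strataReplayBlowupsSettle_of_centreMembersClean {p N : ℕ} {Q : ℕ → (ℕ → ℕ) → ∀ X : Scheme.{u}, X → Prop}
    {G : MarkedStage.{u} → Prop} (hK : StrataCentreMembersClean p N Q G) : StrataReplayBlowupsSettle p N Q G :=
  strataReplayBlowupsSettle_of_cycleStartRegular (strataCycleStartRegular_of_centreMembersClean hK)

/-- **ROW (b) FROM (K-ctr) AND (b-end)** (any `Q`, `G`; p505314's `(c-rep) → (b-end) → (b)` at `QNe Q` with (c-rep) discharged by (K-ctr)).
[cite: CossartJannsenSaito2020, Rem. 6.29 (1)] -/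
theorem strataBirthsSettle_of_centreMembersClean_of_cycleEnd {p N : ℕ} {Q : ℕ → (ℕ → ℕ) → ∀ X : Scheme.{u}, X → Prop}
    {G : MarkedStage.{u} → Prop} (hK : StrataCentreMembersClean p N (QNe Q) G) (hbe : StrataCycleEndBirthsSettle p N (QNe Q) G) :
    StrataBirthsSettle p N (QNe Q) G :=
  strataBirthsSettle_of_replaySettle_of_cycleEnd (strataReplayBlowupsSettle_of_centreMembersClean hK) hbe

end Summit.ResolutionOfSingularities.ResolutionOfSingularities.Theorems.SigmaMaxModificationsCorridor3.Moving

end
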